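import Literature.NumberTheory.EllipticCurves.NeronComponentIndexTypeIVstarExact
import Literature.NumberTheory.EllipticCurves.QuadraticTwistLocalPolynomialProofs
import Literature.NumberTheory.EllipticCurves.QuadraticTwistJInvariantProofs
import HarnessLib

/-!
# Twist models of type-`IV` / `IV*` normal forms, the residual square-class bookkeeping, and the
# square-unit invariance `c(W^{(d)}) = c(W)` (row T-MIL-B = stage B of T-MIL-ODD, file B-2a; seat n1011-p08 GEN 3)

HONEST FRAMING (cell `b2b-bsdres`, run/shared/lean/b2b/bsd-rank1-residual/, verbatim in every
file): the goal of the cell is to DELETE the COMBINATION-SHAPED residual classes of the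
Birch–Swinnerton-Dyer formula for ALL analytic-rank `≤ 1` elliptic curves over `ℚ` — "full BSD
formula for every rank `≤ 1` curve in class `C`" assembled STRICTLY from published theorems — so
that the rank-`≤ 1` remainder becomes exactly the CONSTRUCTION-SHAPED classes, which are TYPED
(missing-input `Prop`s), NOT attempted. This is not "finishing BSD". Sub-classes X3♯(M) / X4(M)
(additive, base-change-and-descend): a RESEARCH ROUTE; they stay CONSTRUCTION-SHAPED; nothing is
booked by this file; no mark / label moved; no consumer binder (`hWR`, `hodd`, A65/A73) changes
before T-MIL-ODD stage C. THEOREMS ONLY: no definition, no named fact, no `sorry`. OUT OF THIS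
ROW (said in every file): the wild sub-case `ℓ = 3 = p ∣ d_K` and `ℓ = 2`.

## What (skeleton `cells/n1011/skel/T-MIL-B.md` §1 (B2)(ii), referee-1 ACK-1 provisos (v))

Let `R` be a HENSELIAN discrete valuation ring with FINITE residue field `k` of ODD
characteristic (`2 ∈ Rˣ`), fraction field `K`, `W/K` an elliptic curve and `d ∈ Rˣ`.

* §1 `localTamagawaNumber_quadraticTwist_eq_of_isSquare_residue` — if `d̄` is a square in `k`
  then `d` is a square in `R` (Hensel on `X² − d`), `W^{(d)} ≅ W` over `K` and
  `c(W^{(d)}/K) = c(W/K)` (ANY reduction type).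
* §2 the explicit `R`-model `J^{(d)} = (0, d b₂/4, 0, d² b₄/2, d³ b₆/4)` of the twist of an
  `R`-model `J` (tree `baseChange_twistLift`) is again a type-`IV` (resp. `IV*`) NORMAL FORM when
  `J` is one, with Step-5/8 quadratic `Y² − ε̄'`, `4ε̄' = d̄³·(γ̄² + 4ε̄)`: the discriminant is
  multiplied by the NON-SQUARE `d̄` (up to squares), so over the finite field `k` EXACTLY ONE of
  the two quadratics has a root.
* THE FLIP itself (`c(W^{(d)}/K) = 3 ↔ c(W/K) = 1` for `d̄` a non-square at a type-`IV`/`IV*`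
  place) is the sequel file `QuadraticTwistTamagawaTypeIVFlip.lean` (B-2b), on top of the exact
  index `NeronComponentIndexTypeIVExact` / `…IVstarExact` (Silverman *ATAEC* IV.9.4 Steps 5, 8,
  printed exact form, over a Henselian ring).

Corroborating print (not used as a fact): T. & V. Dokchitser, *Ann. Math.* 172 (2010) p. 580,
proof of Thm 3.3 Case 4c (types IV, IV* over quadratic extensions; "[33] IV.9.4, Steps 5, 8").
References: Silverman *ATAEC* IV.9.4 Steps 5 and 8 (PDF pp. 344, 346); *AEC* VII.1 Prop. 1.3,
X.5 Cor. 5.4. Place-level wrappers (from `kodairaSymbolAt v W = IV`) and the base-change entries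
(unramified / ramified `e = 2`) are later files of the row.
-/

noncomputable section

open scoped Classical

open WeierstrassCurve IsLocalRing Polynomial
  Literature.NumberTheory.EllipticCurves Literature.NumberTheory.EllipticCurves.LocalIndex
  Literature.NumberTheory.DiophantineGeometry.TateAlgorithm

namespace Summit.BirchSwinnertonDyer.Rank1Residual.AdditivePotMult

namespace TypeIVTwist

/-! ## §0 Residue-field lemmas (finite field of odd characteristic) -/

section Residue

variable {k : Type*} [Field k]

/-- `Y² + aY − c` has a root iff its discriminant `a² + 4c` is a square (characteristic `≠ 2`:
`(2r + a)² = a² + 4c`; conversely `r = (s − a)/2`). [folklore] -/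
theorem exists_root_iff_isSquare [NeZero (2 : k)] (a c : k) :
    (∃ r : k, r ^ 2 + a * r - c = 0) ↔ IsSquare (a ^ 2 + 4 * c) := by
  have h2 : (2 : k) ≠ 0 := two_ne_zero
  constructor
  · rintro ⟨r, hr⟩
    exact ⟨2 * r + a, by linear_combination (-4 : k) * hr⟩
  · rintro ⟨s, hs⟩
    refine ⟨(s - a) / 2, ?_⟩
    field_simp
    linear_combination (-1 : k) * hs

/-- In a FINITE field of odd characteristic, multiplying a non-zero discriminant by a NON-square
flips squareness: `IsSquare (u·x) ↔ ¬ IsSquare x` (`u` non-square, `x ≠ 0`).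
[folklore] -/
theorem isSquare_mul_iff_not_of_not_isSquare [Finite k] {u x : k} (hu : ¬ IsSquare u)
    (hx : x ≠ 0) : IsSquare (u * x) ↔ ¬ IsSquare x := by
  have hu0 : u ≠ 0 := by rintro rfl; exact hu ⟨0, by simp⟩
  rw [isSquare_mul_iff_of_finite hu0 hx]
  tauto

end Residue

/-! ## §1 Square units: `c(W^{(d)}) = c(W)` -/

section DVR

variable {R : Type*} [CommRing R] [IsDomain R] [IsDiscreteValuationRing R]
  {K : Type*} [Field K] [Algebra R K] [IsFractionRing R K]

omit [IsDomain R] [IsDiscreteValuationRing R] in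
/-- Over a Henselian local ring with `2` a unit, a unit whose residue is a square is a square
(Hensel on the monic `X² − d`, simple root since `2θ̄ ≠ 0`). [folklore] -/
theorem exists_sq_eq_of_isSquare_residue [HenselianLocalRing R] (h2 : IsUnit (2 : R)) (d : Rˣ)
    (hsq : IsSquare (residue R (d : R))) : ∃ θ : R, θ ^ 2 = d := by
  obtain ⟨s, hs⟩ := hsq
  obtain ⟨θ₀, hθ₀⟩ := residue_surjective s
  have hs0 : s ≠ 0 := by
    rintro rfl
    exact (residue_ne_zero_iff_isUnit _).mpr d.isUnit (by rw [hs, zero_mul])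
  set g : R[X] := X ^ 2 - C (d : R) with hg
  have hmonic : g.Monic := by
    rw [hg]; exact monic_X_pow_sub_C _ two_ne_zero
  have hev : g.eval θ₀ = θ₀ ^ 2 - d := by
    simp only [hg, eval_sub, eval_pow, eval_X, eval_C]
  have h₁ : g.eval θ₀ ∈ maximalIdeal R := by
    rw [← residue_eq_zero_iff, hev]
    have e : residue R (θ₀ ^ 2 - (d : R)) = s ^ 2 - s * s := by simp [hθ₀, hs]
    rw [e]; ring
  have h₂ : IsUnit (g.derivative.eval θ₀) := by
    rw [← residue_ne_zero_iff_isUnit]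
    have e : g.derivative.eval θ₀ = 2 * θ₀ := by
      rw [hg, derivative_sub, derivative_C, sub_zero, derivative_X_sq, eval_mul, eval_C, eval_X]
    rw [e, map_mul, map_ofNat, hθ₀]
    have h2k : (2 : ResidueField R) ≠ 0 := by
      have h := (residue_ne_zero_iff_isUnit (2 : R)).mpr h2
      rwa [map_ofNat] at h
    exact mul_ne_zero h2k hs0
  obtain ⟨θ, hθ, -⟩ := HenselianLocalRing.is_henselian g hmonic θ₀ h₁ h₂
  refine ⟨θ, ?_⟩
  have : g.eval θ = 0 := hθ
  simp only [hg, eval_sub, eval_pow, eval_X, eval_C] at this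
  linear_combination this

/-- **`c(W^{(d)}/K) = c(W/K)` when `d̄` is a square** (Henselian `R`, `2 ∈ Rˣ`, ANY reduction
type): `d = θ²` in `R`, so `W^{(d)} ≅ W` over `K` (tree `exists_variableChange_smul_eq_quadraticTwist_sq`)
and the local Tamagawa number is an isomorphism invariant (tree
`localTamagawaNumber_variableChange_holds`). [cite: SilvermanAEC2009, X.5 Cor. 5.4 and VII.6 Ex. 7.6] -/
theorem localTamagawaNumber_quadraticTwist_eq_of_isSquare_residue [HenselianLocalRing R]
    (h2 : IsUnit (2 : R)) (W : WeierstrassCurve K) [W.IsElliptic] (d : Rˣ)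
    (hsq : IsSquare (residue R (d : R))) :
    (W.quadraticTwist (algebraMap R K d)).localTamagawaNumber R = W.localTamagawaNumber R := by
  haveI : NeZero (2 : K) := ⟨two_ne_zero_of_isUnit_two R h2⟩
  obtain ⟨θ, hθ⟩ := exists_sq_eq_of_isSquare_residue h2 d hsq
  have hθK : algebraMap R K θ ≠ 0 := by
    intro h0
    rw [map_eq_zero_iff _ (IsFractionRing.injective R K)] at h0
    apply d.ne_zero
    rw [← hθ, h0]; ring
  obtain ⟨C, hC⟩ := W.exists_variableChange_smul_eq_quadraticTwist_sq hθK
  have hd : algebraMap R K (d : R) = algebraMap R K θ ^ 2 := by rw [← map_pow, hθ]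
  rw [hd, ← hC]
  exact localTamagawaNumber_variableChange_holds R W C

/-! ## §2 The twist model of a normal form -/

/-- The explicit `R`-equation of the twist of an `R`-model: for `w = 2 ∈ Rˣ` and `d ∈ R`,
`(0, d b₂(J) w⁻², 0, d² b₄(J) w⁻¹, d³ b₆(J) w⁻²) ⊗ K = (J ⊗ K)^{(d)}` (tree `baseChange_twistLift`
with `integralModel (J ⊗ K) = J`). [folklore] -/
theorem baseChange_twistModel_eq (J : WeierstrassCurve R) (w : Rˣ) (hw : (w : R) = 2) (d : R) :
    (⟨0, d * J.b₂ * ↑w⁻¹ * ↑w⁻¹, 0, d ^ 2 * J.b₄ * ↑w⁻¹, d ^ 3 * J.b₆ * ↑w⁻¹ * ↑w⁻¹⟩ :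
        WeierstrassCurve R).baseChange K = (J.baseChange K).quadraticTwist (algebraMap R K d) := by
  haveI : (J.baseChange K).IsIntegral R := ⟨⟨J, rfl⟩⟩
  have h := baseChange_twistLift R (J.baseChange K) w hw d
  rwa [integralModel_baseChange_eq R J] at h

/-- The residue of `4 · w⁻²` is `1` for `w = 2` (private helper). [folklore] -/
private theorem residue_four_mul_inv_sq (w : Rˣ) (hw : (w : R) = 2) :
    (4 : ResidueField R) * (residue R ((w⁻¹ : Rˣ) : R)) ^ 2 = 1 := by
  obtain ⟨h2k, he⟩ := residue_units_inv_two R hw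
  rw [he, show (4 : ResidueField R) = 2 ^ 2 by norm_num, ← mul_pow, mul_inv_cancel₀ h2k, one_pow]

/-- **The twist model of a type-`IV` normal form is a type-`IV` normal form.** If
`a₁, a₂ ∈ 𝔪`, `a₃ = ϖγ`, `a₄ ∈ 𝔪²`, `a₆ = ϖ²ε`, then for `J' = (0, d b₂ w⁻², 0, d² b₄ w⁻¹, d³ b₆ w⁻²)`:
`a₁' = 0`, `a₂' ∈ 𝔪`, `a₃' = ϖ·0`, `a₄' ∈ 𝔪²`, `a₆' = ϖ²·ε'` with `ε' = d³ w⁻² (γ² + 4ε)` — so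
the Step-5 quadratic of `J'` is `Y² − ε̄'` with `4ε̄' = d̄³(γ̄² + 4ε̄)` (skeleton §1 (B2)(ii);
referee-1 ACK-1 re-verification). [folklore] -/
theorem normalForm_IV_twistModel (J : WeierstrassCurve R) (h1 : J.a₁ ∈ maximalIdeal R)
    (h2 : J.a₂ ∈ maximalIdeal R) {ϖ γ ε : R} (hϖ : Irreducible ϖ) (hγ : J.a₃ = ϖ * γ)
    (h4 : J.a₄ ∈ maximalIdeal R ^ 2) (hε : J.a₆ = ϖ ^ 2 * ε) (w : Rˣ) (d : R) :
    let J' : WeierstrassCurve R :=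
      ⟨0, d * J.b₂ * ↑w⁻¹ * ↑w⁻¹, 0, d ^ 2 * J.b₄ * ↑w⁻¹, d ^ 3 * J.b₆ * ↑w⁻¹ * ↑w⁻¹⟩
    J'.a₁ ∈ maximalIdeal R ∧ J'.a₂ ∈ maximalIdeal R ∧ J'.a₃ = ϖ * 0 ∧
      J'.a₄ ∈ maximalIdeal R ^ 2 ∧ J'.a₆ = ϖ ^ 2 * (d ^ 3 * ↑w⁻¹ * ↑w⁻¹ * (γ ^ 2 + 4 * ε)) := by
  have hm : ϖ ∈ maximalIdeal R := (IsLocalRing.mem_maximalIdeal _).mpr hϖ.not_isUnit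
  have h3 : J.a₃ ∈ maximalIdeal R := hγ ▸ Ideal.mul_mem_right _ _ hm
  refine ⟨zero_mem _, ?_, by simp, ?_, ?_⟩
  · -- `a₂' = d b₂ w⁻²`, `b₂ = a₁² + 4a₂ ∈ 𝔪`
    have hb₂ : J.b₂ ∈ maximalIdeal R := by
      rw [WeierstrassCurve.b₂]
      exact Ideal.add_mem _ (by rw [sq]; exact Ideal.mul_mem_left _ _ h1)
        (Ideal.mul_mem_left _ _ h2)
    change d * J.b₂ * ↑w⁻¹ * ↑w⁻¹ ∈ maximalIdeal R
    exact Ideal.mul_mem_right _ _ (Ideal.mul_mem_right _ _ (Ideal.mul_mem_left _ _ hb₂))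
  · -- `a₄' = d² b₄ w⁻¹`, `b₄ = 2a₄ + a₁a₃ ∈ 𝔪²`
    have hb₄ : J.b₄ ∈ maximalIdeal R ^ 2 := by
      rw [WeierstrassCurve.b₄]
      refine Ideal.add_mem _ (Ideal.mul_mem_left _ _ h4) ?_
      rw [sq]
      exact Ideal.mul_mem_mul h1 h3
    change d ^ 2 * J.b₄ * ↑w⁻¹ ∈ maximalIdeal R ^ 2
    exact Ideal.mul_mem_right _ _ (Ideal.mul_mem_left _ _ hb₄)
  · -- `a₆' = d³ b₆ w⁻²`, `b₆ = a₃² + 4a₆ = ϖ²(γ² + 4ε)`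
    change d ^ 3 * J.b₆ * ↑w⁻¹ * ↑w⁻¹ = _
    rw [WeierstrassCurve.b₆, hγ, hε]; ring

/-- **The twist model of a type-`IV*` normal form is a type-`IV*` normal form**: `a₁ ∈ 𝔪`,
`a₂ ∈ 𝔪²`, `a₃ = ϖ²γ`, `a₄ ∈ 𝔪³`, `a₆ = ϖ⁴ε` give `a₂' ∈ 𝔪²`, `a₃' = ϖ²·0`, `a₄' ∈ 𝔪³`,
`a₆' = ϖ⁴·ε'` with `ε' = d³ w⁻² (γ² + 4ε)`. [folklore] -/
theorem normalForm_IVstar_twistModel (J : WeierstrassCurve R) (h1 : J.a₁ ∈ maximalIdeal R)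
    (h2 : J.a₂ ∈ maximalIdeal R ^ 2) {ϖ γ ε : R} (hϖ : Irreducible ϖ) (hγ : J.a₃ = ϖ ^ 2 * γ)
    (h4 : J.a₄ ∈ maximalIdeal R ^ 3) (hε : J.a₆ = ϖ ^ 4 * ε) (w : Rˣ) (d : R) :
    let J' : WeierstrassCurve R :=
      ⟨0, d * J.b₂ * ↑w⁻¹ * ↑w⁻¹, 0, d ^ 2 * J.b₄ * ↑w⁻¹, d ^ 3 * J.b₆ * ↑w⁻¹ * ↑w⁻¹⟩
    J'.a₁ ∈ maximalIdeal R ∧ J'.a₂ ∈ maximalIdeal R ^ 2 ∧ J'.a₃ = ϖ ^ 2 * 0 ∧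
      J'.a₄ ∈ maximalIdeal R ^ 3 ∧ J'.a₆ = ϖ ^ 4 * (d ^ 3 * ↑w⁻¹ * ↑w⁻¹ * (γ ^ 2 + 4 * ε)) := by
  have hm : ϖ ∈ maximalIdeal R := (IsLocalRing.mem_maximalIdeal _).mpr hϖ.not_isUnit
  have h3 : J.a₃ ∈ maximalIdeal R ^ 2 := hγ ▸ Ideal.mul_mem_right _ _ (Ideal.pow_mem_pow hm 2)
  refine ⟨zero_mem _, ?_, by simp, ?_, ?_⟩
  · have hb₂ : J.b₂ ∈ maximalIdeal R ^ 2 := by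
      rw [WeierstrassCurve.b₂]
      refine Ideal.add_mem _ ?_ (Ideal.mul_mem_left _ _ h2)
      rw [sq, sq]
      exact Ideal.mul_mem_mul h1 h1
    change d * J.b₂ * ↑w⁻¹ * ↑w⁻¹ ∈ maximalIdeal R ^ 2
    exact Ideal.mul_mem_right _ _ (Ideal.mul_mem_right _ _ (Ideal.mul_mem_left _ _ hb₂))
  · have hb₄ : J.b₄ ∈ maximalIdeal R ^ 3 := by
      rw [WeierstrassCurve.b₄]
      refine Ideal.add_mem _ (Ideal.mul_mem_left _ _ h4) ?_
      rw [show (3 : ℕ) = 1 + 2 by norm_num, pow_add, pow_one]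
      exact Ideal.mul_mem_mul h1 h3
    change d ^ 2 * J.b₄ * ↑w⁻¹ ∈ maximalIdeal R ^ 3
    exact Ideal.mul_mem_right _ _ (Ideal.mul_mem_left _ _ hb₄)
  · change d ^ 3 * J.b₆ * ↑w⁻¹ * ↑w⁻¹ = _
    rw [WeierstrassCurve.b₆, hγ, hε]; ring

/-- **The discriminants of the two Step-5/8 quadratics differ by the factor `d̄` up to squares**:
for `ε' = d³ w⁻² (γ² + 4ε)` (`w = 2`), `0̄² + 4ε̄' = d̄² · (d̄ · (γ̄² + 4ε̄))`. [folklore] -/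
theorem disc_twistModel_eq (w : Rˣ) (hw : (w : R) = 2) (d γ ε : R) :
    residue R 0 ^ 2 + 4 * residue R (d ^ 3 * ↑w⁻¹ * ↑w⁻¹ * (γ ^ 2 + 4 * ε)) =
      residue R d ^ 2 * (residue R d * (residue R γ ^ 2 + 4 * residue R ε)) := by
  have h4 := residue_four_mul_inv_sq w hw
  simp only [map_zero, map_mul, map_pow, map_add, map_ofNat]
  linear_combination (residue R d) ^ 3 * (residue R γ ^ 2 + 4 * residue R ε) * h4

/-- Over a FINITE residue field of odd characteristic, for `d̄` a NON-square and a separable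
quadratic (`γ̄² + 4ε̄ ≠ 0`): the twisted quadratic `Y² − ε̄'` has a root iff the original
`Y² + γ̄Y − ε̄` has NONE. [folklore] -/
theorem exists_root_twistModel_iff_not [Finite (ResidueField R)] [NeZero (2 : ResidueField R)]
    (w : Rˣ) (hw : (w : R) = 2) {d : Rˣ} (hns : ¬ IsSquare (residue R (d : R))) {γ ε : R}
    (hdisc : residue R γ ^ 2 + 4 * residue R ε ≠ 0) :
    (∃ r : ResidueField R,
        r ^ 2 + residue R 0 * r - residue R ((d : R) ^ 3 * ↑w⁻¹ * ↑w⁻¹ * (γ ^ 2 + 4 * ε)) = 0) ↔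
      ¬ ∃ r : ResidueField R, r ^ 2 + residue R γ * r - residue R ε = 0 := by
  rw [exists_root_iff_isSquare, exists_root_iff_isSquare, disc_twistModel_eq w hw,
    isSquare_mul_sq_iff (residue_units_ne_zero R d),
    isSquare_mul_iff_not_of_not_isSquare hns hdisc]

end DVR

end TypeIVTwist

end Summit.BirchSwinnertonDyer.Rank1Residual.AdditivePotMult

end
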